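import Mathlib
import Summits.ResolutionOfSingularities.ResolutionOfSingularities.Theorems.WildQuotientsWildQuotientResolutionJordanFourParity
import Summits.ResolutionOfSingularities.ResolutionOfSingularities.Theorems.WildQuotientsWildQuotientResolutionToricExitTranslationFixed
import Summits.ResolutionOfSingularities.ResolutionOfSingularities.Theorems.WildQuotientsWildQuotientResolutionToricExitRootChartFour
import Summits.ResolutionOfSingularities.ResolutionOfSingularities.Theorems.WildQuotientsWildQuotientResolutionToricExitRootChartInvariants

/-!
# V4U piece T — invariants of the translation `Σ_T : ξ ↦ ξ + s` on the twisted root chart: all of them, and the even ones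

(crux stmt-ResolutionOfSingularities-15640 `WildQuotients.WildQuotientResolution`, line `Sketch`,
sector `|G| = p`; programme V4U of `L/w45c/CHAIN.md` v6 §4 row stub-1 (T1 «`twistedChart_fixedPoints_eq`
(B1 with `ρ := X b`, NO correction terms) + the even ∩ fixed form (parity, odd set `{a,b,c}`)») and
`L/w45c/V4U-DESIGN.md` §3 («(k[s,A,ξ,η,pass])^{Σ_T} = k[s, A, N, η, pass]», «Γ(W_T)^σ = (E_Q)^{Σ_T} =
(adjoin k {s², sA, sN, A², AN, N²} ∪ {η} ∪ pass)[1/Q] = (½(1,1,1)-cone ⊗ k[η, pass])_Q»).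
[OURS · L1 W4.5c] — NOT a statement of any manuscript; replaces the role of no printed item.
Prover res-L1-w45c-stub-1.)

Slots `s = X b`, `A = X a`, `ξ = X c`, `η = X d`; `N := ξ^p − s^{p−1} ξ = X c ^ p − X b ^ (p−1) * X c`
(the Artin–Schreier element of the translation `ξ ↦ ξ + s`; ODD for the parity grading).
* `translate_fixedPoints_eq` — for ANY `k`-algebra endomorphism `τ` with `τ (X c) = X c + X b` and
  `τ (X i) = X i` (`i ≠ c`), prime characteristic `p`:
  `{f | τ f = f} = k[N, X i (i ≠ c)]` (B1 `ToricExit.fixedPoints_translate` via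
  `ToricExit.mem_adjoin_of_translate_eq`, p488136 — no correction terms at all).
* `translate_fixedPoints_inter_even_eq` — `{f ∈ E | τ f = f} = adjoin k ({s², sA, sN, A², AN, N²} ∪
  {X i : i ∉ {a,b,c}})` (`p` odd), the coordinate ring of the `½(1,1,1)`-cone `× 𝔸^{1+m}`: the
  route of V3U-C2 (`ToricExit.chartA_fixedPoints_eq`) — a fixed `f = P(N, other variables)`, the
  substitution preserves the parity grading (`N` odd), so an even `f` is the image of the even part
  of `P`, which lies in `E` and maps to the cone algebra.
No algebraic independence of `s, A, N` is used (that is stub-4's C3½/C4½).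
-/

-- single-problem summit: the doubled namespace component `ResolutionOfSingularities` is forced
set_option linter.dupNamespace false

noncomputable section

open MvPolynomial

namespace Summit.ResolutionOfSingularities.ResolutionOfSingularities.Theorems.WildQuotientResolution.JordanFour

variable (k : Type) [Field k] (n : ℕ) (a b c : Fin n) (hab : a ≠ b) (hac : a ≠ c) (hbc : b ≠ c)
  (τ : MvPolynomial (Fin n) k →ₐ[k] MvPolynomial (Fin n) k)
  (hτc : τ (X c) = X c + X b) (hτ : ∀ i, i ≠ c → τ (X i) = X i)

include hbc hτc hτ in
/-- `N = ξ^p − s^{p−1}ξ` is `Σ_T`-invariant (Artin–Schreier). [folklore] -/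
theorem translate_artinSchreier (p : ℕ) (hp : p.Prime) [CharP k p] :
    τ (X c ^ p - X b ^ (p - 1) * X c) = X c ^ p - X b ^ (p - 1) * X c := by
  haveI : Fact p.Prime := ⟨hp⟩
  exact ToricExit.rootChart4_artinSchreier (τ : MvPolynomial (Fin n) k →+* MvPolynomial (Fin n) k)
    b c (hτ b hbc) hτc p

include hbc hτc hτ in
/-- **All invariants of the translation `ξ ↦ ξ + s`**: `{f | Σ_T f = f} = k[N, X i (i ≠ c)]`,
`N = ξ^p − s^{p−1}ξ` — B1 verbatim with `ρ := s`, no correction terms. [OURS · L1 W4.5c]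
[folklore: Artin–Schreier] -/
theorem translate_fixedPoints_eq (p : ℕ) (hp : p.Prime) [CharP k p] :
    {f : MvPolynomial (Fin n) k | τ f = f} =
      (Algebra.adjoin k (({X c ^ p - X b ^ (p - 1) * X c} : Set (MvPolynomial (Fin n) k)) ∪
        ((fun i => X i) '' {i | i ≠ c})) : Set (MvPolynomial (Fin n) k)) := by
  classical
  -- `τ` is the translation `aeval`
  have hτ' : τ = aeval (fun i : Fin n => if i = c then X c + X b else (X i : MvPolynomial (Fin n) k)) := by
    refine MvPolynomial.algHom_ext fun i => ?_
    rw [aeval_X]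
    by_cases hic : i = c
    · subst hic; rw [if_pos rfl, hτc]
    · rw [if_neg hic, hτ i hic]
  apply Set.Subset.antisymm
  · intro f hf
    have hf' : aeval (fun i : Fin n => if i = c then X c + X b else (X i : MvPolynomial (Fin n) k)) f
        = f := by rw [← hτ']; exact hf
    exact ToricExit.mem_adjoin_of_translate_eq k n b c hbc p hp f hf'
  · intro f hf
    have hle : Algebra.adjoin k (({X c ^ p - X b ^ (p - 1) * X c} : Set (MvPolynomial (Fin n) k)) ∪
        ((fun i => X i) '' {i | i ≠ c})) ≤
          AlgHom.equalizer τ (AlgHom.id k (MvPolynomial (Fin n) k)) := by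
      refine Algebra.adjoin_le ?_
      intro x hx
      rw [SetLike.mem_coe, AlgHom.mem_equalizer, AlgHom.id_apply]
      rcases hx with hx | ⟨i, hic, rfl⟩
      · rw [Set.mem_singleton_iff] at hx
        subst hx
        exact translate_artinSchreier k n b c hbc τ hτc hτ p hp
      · exact hτ i hic
    have h := hle hf
    rw [AlgHom.mem_equalizer, AlgHom.id_apply] at h
    exact h

include hab hac hbc hτc hτ in
/-- **The EVEN invariants of the translation: the `½(1,1,1)`-cone** (`p` an odd prime):
`{f ∈ E | Σ_T f = f} = adjoin k ({s², sA, sN, A², AN, N²} ∪ {X i : i ∉ {a, b, c}})`,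
`E = adjoin k (evenGens k n a b c)`, `N = X c ^ p − X b ^ (p−1) * X c`. [OURS · L1 W4.5c] -/
theorem translate_fixedPoints_inter_even_eq (p : ℕ) (hp : p.Prime) (hp2 : p ≠ 2) [CharP k p] :
    {f : MvPolynomial (Fin n) k | f ∈ Algebra.adjoin k (evenGens k n a b c) ∧ τ f = f} =
      (Algebra.adjoin k (({X b ^ 2, X b * X a, X b * (X c ^ p - X b ^ (p - 1) * X c), X a ^ 2,
          X a * (X c ^ p - X b ^ (p - 1) * X c), (X c ^ p - X b ^ (p - 1) * X c) ^ 2} :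
          Set (MvPolynomial (Fin n) k)) ∪
        ((fun i => X i) '' {i | i ≠ a ∧ i ≠ b ∧ i ≠ c})) : Set (MvPolynomial (Fin n) k)) := by
  classical
  have hpodd : (p : ZMod 2) = 1 := ToricExit.natCast_zmod_two_of_odd (hp.odd_of_ne_two hp2)
  have hp1 : p - 1 + 1 = p := Nat.sub_add_cancel hp.one_lt.le
  -- the parity weight
  let w : Fin n → ZMod 2 := fun i => if i = a ∨ i = b ∨ i = c then 1 else 0
  have hwa : w a = 1 := if_pos (Or.inl rfl)
  have hwb : w b = 1 := if_pos (Or.inr (Or.inl rfl))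
  have hwc : w c = 1 := if_pos (Or.inr (Or.inr rfl))
  have hw0 : ∀ i, i ≠ a → i ≠ b → i ≠ c → w i = 0 :=
    fun i hia hib hic => if_neg (not_or.mpr ⟨hia, not_or.mpr ⟨hib, hic⟩⟩)
  have hE : ∀ f, f ∈ Algebra.adjoin k (evenGens k n a b c) ↔ IsWeightedHomogeneous w f 0 :=
    mem_adjoin_evenGens_iff k n a b c hab hac hbc w hwa hwb hwc hw0
  -- the invariant generator `N` and the parities
  set N : MvPolynomial (Fin n) k := X c ^ p - X b ^ (p - 1) * X c with hN
  have hX1 : ∀ i, w i = 1 → IsWeightedHomogeneous w (X i : MvPolynomial (Fin n) k) 1 := by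
    intro i hi
    have h := isWeightedHomogeneous_X k w i
    rwa [hi] at h
  have hXa := hX1 a hwa
  have hXb := hX1 b hwb
  have hXc := hX1 c hwc
  have e11 : (1 : ZMod 2) + 1 = 0 := ToricExit.one_add_one_zmod_two
  have hNodd : IsWeightedHomogeneous w N 1 := by
    have h1 : IsWeightedHomogeneous w (X c ^ p : MvPolynomial (Fin n) k) 1 := by
      have h := hXc.pow p
      rwa [nsmul_eq_mul, mul_one, hpodd] at h
    have h2' : IsWeightedHomogeneous w (X b ^ (p - 1) * X c : MvPolynomial (Fin n) k) 1 := by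
      have h := (hXb.pow (p - 1)).mul hXc
      rwa [nsmul_eq_mul, mul_one, ← Nat.cast_add_one, hp1, hpodd] at h
    exact (weightedHomogeneousSubmodule k w 1).sub_mem h1 h2'
  -- the generator family `g` and its parity
  let g : Fin n → MvPolynomial (Fin n) k := fun i => if i = c then N else X i
  have hgc : g c = N := if_pos rfl
  have hgi : ∀ i, i ≠ c → g i = X i := fun i hic => if_neg hic
  have hgw : ∀ i, IsWeightedHomogeneous w (g i) (w i) := by
    intro i
    by_cases hic : i = c
    · subst hic
      rw [hgc, hwc]
      exact hNodd
    · rw [hgi i hic]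
      exact isWeightedHomogeneous_X k w i
  -- `k[N, xᵢ (i ≠ c)] ≤ range (aeval g)`
  have hFle : Algebra.adjoin k (({X c ^ p - X b ^ (p - 1) * X c} : Set (MvPolynomial (Fin n) k)) ∪
      ((fun i => X i) '' {i | i ≠ c})) ≤
        (aeval g : MvPolynomial (Fin n) k →ₐ[k] MvPolynomial (Fin n) k).range := by
    refine Algebra.adjoin_le ?_
    rintro x hx
    rcases hx with hx | ⟨i, hic, rfl⟩
    · rw [Set.mem_singleton_iff] at hx
      subst hx
      exact (AlgHom.mem_range _).mpr ⟨X c, by rw [aeval_X, hgc]⟩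
    · exact (AlgHom.mem_range _).mpr ⟨X i, by rw [aeval_X, hgi i hic]⟩
  -- the images of the even generators are the cone generators
  set T := Algebra.adjoin k (({X b ^ 2, X b * X a, X b * (X c ^ p - X b ^ (p - 1) * X c), X a ^ 2,
      X a * (X c ^ p - X b ^ (p - 1) * X c), (X c ^ p - X b ^ (p - 1) * X c) ^ 2} :
      Set (MvPolynomial (Fin n) k)) ∪
    ((fun i => X i) '' {i | i ≠ a ∧ i ≠ b ∧ i ≠ c})) with hT
  have hga : g a = X a := hgi a hac
  have hgb : g b = X b := hgi b hbc
  have hTbb : (X b ^ 2 : MvPolynomial (Fin n) k) ∈ T := Algebra.subset_adjoin (Or.inl (by simp))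
  have hTba : (X b * X a : MvPolynomial (Fin n) k) ∈ T := Algebra.subset_adjoin (Or.inl (by simp))
  have hTbN : (X b * N : MvPolynomial (Fin n) k) ∈ T := Algebra.subset_adjoin (Or.inl (by simp [hN]))
  have hTaa : (X a ^ 2 : MvPolynomial (Fin n) k) ∈ T := Algebra.subset_adjoin (Or.inl (by simp))
  have hTaN : (X a * N : MvPolynomial (Fin n) k) ∈ T := Algebra.subset_adjoin (Or.inl (by simp [hN]))
  have hTNN : (N ^ 2 : MvPolynomial (Fin n) k) ∈ T := Algebra.subset_adjoin (Or.inl (by simp [hN]))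
  have himg : Subalgebra.map (aeval g : MvPolynomial (Fin n) k →ₐ[k] MvPolynomial (Fin n) k)
      (Algebra.adjoin k (evenGens k n a b c)) ≤ T := by
    rw [AlgHom.map_adjoin]
    refine Algebra.adjoin_le ?_
    rintro _ ⟨x, hx, rfl⟩
    rcases hx with hx | ⟨i, ⟨hia, hib, hic⟩, rfl⟩
    · simp only [Set.mem_insert_iff, Set.mem_singleton_iff] at hx
      rcases hx with rfl | rfl | rfl | rfl | rfl | rfl
      · rw [map_pow, aeval_X, hga]; exact hTaa
      · rw [map_mul, aeval_X, aeval_X, hga, hgb, mul_comm]; exact hTba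
      · rw [map_mul, aeval_X, aeval_X, hga, hgc]; exact hTaN
      · rw [map_pow, aeval_X, hgb]; exact hTbb
      · rw [map_mul, aeval_X, aeval_X, hgb, hgc]; exact hTbN
      · rw [map_pow, aeval_X, hgc]; exact hTNN
    · change aeval g (X i) ∈ T
      rw [aeval_X, hgi i hic]
      exact Algebra.subset_adjoin (Or.inr ⟨i, ⟨hia, hib, hic⟩, rfl⟩)
  apply Set.Subset.antisymm
  · -- `⊆`: an even fixed `f` is `aeval g` of an even polynomial
    rintro f ⟨hfS, hfτ⟩
    have hf0 : IsWeightedHomogeneous w f 0 := (hE f).mp hfS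
    have hfF : f ∈ Algebra.adjoin k (({X c ^ p - X b ^ (p - 1) * X c} : Set (MvPolynomial (Fin n) k)) ∪
        ((fun i => X i) '' {i | i ≠ c})) := by
      rw [← SetLike.mem_coe, ← translate_fixedPoints_eq k n b c hbc τ hτc hτ p hp]
      exact hfτ
    obtain ⟨P, hP⟩ := (AlgHom.mem_range _).mp (hFle hfF)
    have hPdec := ToricExit.eq_add_weightedHomogeneousComponent k n w P
    have hP₀ : IsWeightedHomogeneous w (weightedHomogeneousComponent w 0 P) 0 :=
      weightedHomogeneousComponent_isWeightedHomogeneous 0 P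
    have hP₁ : IsWeightedHomogeneous w (weightedHomogeneousComponent w 1 P) 1 :=
      weightedHomogeneousComponent_isWeightedHomogeneous 1 P
    have h0 := ToricExit.isWeightedHomogeneous_aeval w w g hgw _ 0 hP₀
    have h1 := ToricExit.isWeightedHomogeneous_aeval w w g hgw _ 1 hP₁
    have hsum : aeval g (weightedHomogeneousComponent w 0 P) +
        aeval g (weightedHomogeneousComponent w 1 P) = f := by
      rw [← map_add, ← hPdec, hP]
    have h1' : IsWeightedHomogeneous w (aeval g (weightedHomogeneousComponent w 1 P)) 0 := by
      have e : aeval g (weightedHomogeneousComponent w 1 P) =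
          f - aeval g (weightedHomogeneousComponent w 0 P) := by rw [← hsum]; ring
      rw [e]
      exact (weightedHomogeneousSubmodule k w 0).sub_mem hf0 h0
    have hz : aeval g (weightedHomogeneousComponent w 1 P) = 0 :=
      ToricExit.eq_zero_of_isWeightedHomogeneous_zero_one k n w _ h1' h1
    have hfP₀ : f = aeval g (weightedHomogeneousComponent w 0 P) := by
      rw [← hsum, hz, add_zero]
    have hP₀mem : weightedHomogeneousComponent w 0 P ∈ Algebra.adjoin k (evenGens k n a b c) :=
      (hE _).mpr hP₀
    rw [hfP₀]
    exact himg (Subalgebra.mem_map.mpr ⟨_, hP₀mem, rfl⟩)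
  · -- `⊇`: the cone generators are even and fixed
    intro f hf
    have hτa : τ (X a) = X a := hτ a hac
    have hτb : τ (X b) = X b := hτ b hbc
    have hτN : τ N = N := translate_artinSchreier k n b c hbc τ hτc hτ p hp
    have hle : T ≤ Algebra.adjoin k (evenGens k n a b c) ⊓
        AlgHom.equalizer τ (AlgHom.id k (MvPolynomial (Fin n) k)) := by
      refine Algebra.adjoin_le ?_
      intro x hx
      rw [SetLike.mem_coe, Algebra.mem_inf, AlgHom.mem_equalizer, AlgHom.id_apply]
      rcases hx with hx | ⟨i, ⟨hia, hib, hic⟩, rfl⟩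
      · simp only [Set.mem_insert_iff, Set.mem_singleton_iff] at hx
        rcases hx with rfl | rfl | rfl | rfl | rfl | rfl
        · refine ⟨(hE _).mpr ?_, by rw [map_pow, hτb]⟩
          have h := hXb.mul hXb
          rwa [← sq, e11] at h
        · refine ⟨(hE _).mpr ?_, by rw [map_mul, hτb, hτa]⟩
          have h := hXb.mul hXa
          rwa [e11] at h
        · refine ⟨(hE _).mpr ?_, by rw [map_mul, hτb, hτN]⟩
          have h := hXb.mul hNodd
          rwa [e11] at h
        · refine ⟨(hE _).mpr ?_, by rw [map_pow, hτa]⟩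
          have h := hXa.mul hXa
          rwa [← sq, e11] at h
        · refine ⟨(hE _).mpr ?_, by rw [map_mul, hτa, hτN]⟩
          have h := hXa.mul hNodd
          rwa [e11] at h
        · refine ⟨(hE _).mpr ?_, by rw [map_pow, hτN]⟩
          have h := hNodd.mul hNodd
          rwa [← sq, e11] at h
      · exact ⟨Algebra.subset_adjoin (Or.inr ⟨i, ⟨hia, hib, hic⟩, rfl⟩), hτ i hic⟩
    have h := hle hf
    rw [Algebra.mem_inf, AlgHom.mem_equalizer, AlgHom.id_apply] at h
    exact ⟨h.1, h.2⟩

end Summit.ResolutionOfSingularities.ResolutionOfSingularities.Theorems.WildQuotientResolution.JordanFour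

end
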